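import Literature.MathematicalPhysics.QuantumLattice.FockFirstQuantization
import Literature.MathematicalPhysics.QuantumLattice.FermionGammaFunctor
import Literature.MathematicalPhysics.QuantumLattice.PairCorrelationsProofs
import HarnessLib

/-!
# Yang's geminal annihilator on Slater states: the coordinate bound `‖P_w |T⟩‖² ≤ 2‖w‖²`

Topic `MathematicalPhysics/QuantumLattice`, family `hubbard` (written for route `SignStructure`,
support `SlaterRankBound`, stmt-HubbardSuperconductivity-2140; generic Fock-space facts).

Algebraic ingredients for the Slater rank bound `Re v†ρ₂(Σ_a α_a Φ_a)v ≤ 2(Σ_a |α_a|‖Φ_a‖)²‖v‖²`: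

* `slater_prod_eq` — the first-quantised Slater state of PRODUCT orbitals is the product of
  smeared creation operators on the vacuum, `|∏_k φ_k(o_k)⟩ = c†(φ₀) ⋯ c†(φ_{N-1}) |∅⟩`;
* `pairAnnihilator_mul_Gamma` — Yang's geminal annihilator passes through the second
  quantisation `Γ(h)` of ANY one-body matrix, `P_v Γ(h) = Γ(h) P_{hᵀ v h}`, and for unitary `h`
  the Frobenius norm of the pair function is unchanged (`star_dotProduct_pairMap_self`);
* `normSq_pairAnnihilator_single_le` — on an occupation-basis vector `|T⟩` (a coordinate Slater
  determinant) `‖P_w |T⟩‖² ≤ 2 ‖w‖²` (at most the two orderings of the removed pair contribute to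
  each coefficient).

Sources: C. N. Yang, Rev. Mod. Phys. 34 (1962) 694, §3; A. J. Coleman, Rev. Mod. Phys. 35 (1963)
668; O. Bratteli, D. W. Robinson II §5.2.1 (`Γ(U) a(f) Γ(U)* = a(Uf)`). No definition is introduced.
-/

namespace Literature.MathematicalPhysics.QuantumLattice

open Matrix Finset
open Literature.MathematicalPhysics.QuantumLattice.RayleighBound

variable {ι : Type*} [LinearOrder ι] [Fintype ι]

/-! ### The product form of a Slater state -/

/-- **Slater states of product orbitals are products of smeared creation operators**:
`|o ↦ ∏_k φ_k(o_k)⟩ = c†(φ₀) c†(φ₁) ⋯ c†(φ_{N-1}) |∅⟩` (multilinearity of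
`FirstQuant.slater`). [cite: BratteliRobinsonII1997, §5.2.1] -/
theorem slater_prod_eq {N : ℕ} (φ : Fin N → ι → ℂ) :
    FirstQuant.slater (fun o : Fin N → ι => ∏ k, φ k (o k)) =
      (List.ofFn fun k => create (φ k)).prod *ᵥ (vacuum : Fock ι) := by
  induction N with
  | zero =>
    rw [List.ofFn_zero, List.prod_nil, one_mulVec, FirstQuant.slater, Fintype.sum_unique]
    simp
  | succ N ih =>
    have hL : FirstQuant.slater (fun o : Fin (N + 1) → ι => ∏ k, φ k (o k)) =
        ∑ i : ι, ∑ o : Fin N → ι, (φ 0 i * ∏ k : Fin N, φ k.succ (o k)) •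
          ((creation i * FirstQuant.prodCreation o) *ᵥ (vacuum : Fock ι)) := by
      rw [FirstQuant.slater, ← (Fin.consEquiv fun _ : Fin (N + 1) => ι).sum_comp, Fintype.sum_prod_type]
      refine Finset.sum_congr rfl fun i _ => Finset.sum_congr rfl fun o _ => ?_
      have hc : (Fin.consEquiv fun _ : Fin (N + 1) => ι) (i, o) = Fin.cons i o := rfl
      rw [hc, Fin.prod_univ_succ, Fin.cons_zero, FirstQuant.prodCreation_succ, Fin.cons_zero, Fin.tail_cons]
      simp only [Fin.cons_succ]
    rw [hL, List.ofFn_succ, List.prod_cons, ← mulVec_mulVec, ← ih (fun k => φ k.succ),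
      FirstQuant.slater, create, sum_mulVec]
    refine Finset.sum_congr rfl fun i _ => ?_
    rw [smul_mulVec, Matrix.mulVec_sum, Finset.smul_sum]
    refine Finset.sum_congr rfl fun o _ => ?_
    rw [mulVec_smul, smul_smul, mulVec_mulVec]

/-! ### Yang's geminal annihilator and the second quantisation `Γ(h)` -/

/-- **`c_j Γ(h) = Γ(h) Σ_l h_{jl} c_l`**: annihilation operators pass through `Γ(h)` (adjoint of
the intertwining `Γ(hᴴ) c†_j = c†(hᴴ e_j) Γ(hᴴ)`). [cite: BratteliRobinsonII1997, §5.2.1] -/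
theorem annihilation_mul_Gamma (h : Matrix ι ι ℂ) (j : ι) :
    annihilation j * Gamma h = Gamma h * ∑ l, h j l • annihilation l := by
  have key := congr_arg conjTranspose (Gamma_mul_creation hᴴ j)
  rw [conjTranspose_mul, conjTranspose_mul, creation_conjTranspose, ← Gamma_conjTranspose,
    conjTranspose_conjTranspose, create_conjTranspose] at key
  rw [key, annihilate]
  congr 1
  refine Finset.sum_congr rfl fun l _ => ?_
  rw [conjTranspose_apply, star_star]

/-- The transformed pair function `(hᵀ v h)(k,l) = Σ_{(i,j)} h_{ik} v(i,j) h_{jl}` (stated as a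
plain sum; no definition). **`P_v Γ(h) = Γ(h) P_{hᵀ v h}`** for Yang's geminal annihilator
`P_v = Σ v(i,j) c_j c_i`. [cite: Yang1962, §3] -/
theorem pairAnnihilator_mul_Gamma (h : Matrix ι ι ℂ) (v : ι × ι → ℂ) :
    pairAnnihilator v * Gamma h =
      Gamma h * pairAnnihilator (fun q : ι × ι => ∑ p : ι × ι, h p.1 q.1 * v p * h p.2 q.2) := by
  have h2 : ∀ p : ι × ι, annihilation p.2 * annihilation p.1 * Gamma h =
      Gamma h * ∑ q : ι × ι, (h p.1 q.1 * h p.2 q.2) • (annihilation q.2 * annihilation q.1) := by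
    intro p
    rw [mul_assoc, annihilation_mul_Gamma, ← mul_assoc, annihilation_mul_Gamma, mul_assoc,
      Finset.sum_mul, Fintype.sum_prod_type]
    congr 1
    rw [Finset.sum_comm]
    refine Finset.sum_congr rfl fun l _ => ?_
    rw [Finset.mul_sum]
    refine Finset.sum_congr rfl fun k _ => ?_
    rw [smul_mul_smul_comm, mul_comm (h p.2 l)]
  unfold pairAnnihilator
  rw [Finset.sum_mul, Finset.mul_sum]
  calc ∑ p : ι × ι, (v p • (annihilation p.2 * annihilation p.1)) * Gamma h
      = ∑ p : ι × ι, ∑ q : ι × ι, (v p * (h p.1 q.1 * h p.2 q.2)) •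
          (Gamma h * (annihilation q.2 * annihilation q.1)) := by
        refine Finset.sum_congr rfl fun p _ => ?_
        rw [Matrix.smul_mul, h2, Matrix.mul_sum, Finset.smul_sum]
        refine Finset.sum_congr rfl fun q _ => ?_
        rw [Matrix.mul_smul, smul_smul]
    _ = ∑ q : ι × ι, Gamma h * ((∑ p : ι × ι, h p.1 q.1 * v p * h p.2 q.2) •
          (annihilation q.2 * annihilation q.1)) := by
        rw [Finset.sum_comm]
        refine Finset.sum_congr rfl fun q _ => ?_
        rw [Matrix.mul_smul, Finset.sum_smul]
        refine Finset.sum_congr rfl fun p _ => ?_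
        congr 1
        ring

omit [LinearOrder ι] in
/-- `Σ_{(i,j)} star(M i j) M i j = Tr (Mᴴ M)` (squared Frobenius norm of a matrix read as a pair
function). [folklore] -/
theorem star_dotProduct_uncurry_eq_trace (M : Matrix ι ι ℂ) :
    star (fun q : ι × ι => M q.1 q.2) ⬝ᵥ (fun q : ι × ι => M q.1 q.2) = (Mᴴ * M).trace := by
  rw [dotProduct, Fintype.sum_prod_type, Matrix.trace, Finset.sum_comm]
  refine Finset.sum_congr rfl fun j _ => ?_
  rw [Matrix.diag_apply, Matrix.mul_apply]
  refine Finset.sum_congr rfl fun i _ => ?_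
  rfl

/-- **A unitary change of orbitals preserves the norm of a pair function**:
`‖hᵀ v h‖² = ‖v‖²` for unitary `h`. [folklore] -/
theorem star_dotProduct_pairMap_self {h : Matrix ι ι ℂ} (hh : h ∈ Matrix.unitaryGroup ι ℂ)
    (v : ι × ι → ℂ) :
    star (fun q : ι × ι => ∑ p : ι × ι, h p.1 q.1 * v p * h p.2 q.2) ⬝ᵥ
        (fun q : ι × ι => ∑ p : ι × ι, h p.1 q.1 * v p * h p.2 q.2) = star v ⬝ᵥ v := by
  set V : Matrix ι ι ℂ := Matrix.of fun i j => v (i, j) with hV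
  have hmat : (fun q : ι × ι => ∑ p : ι × ι, h p.1 q.1 * v p * h p.2 q.2) =
      fun q : ι × ι => (hᵀ * V * h) q.1 q.2 := by
    funext q
    rw [Matrix.mul_apply, Fintype.sum_prod_type, Finset.sum_comm]
    refine Finset.sum_congr rfl fun j _ => ?_
    rw [Matrix.mul_apply, Finset.sum_mul]
    refine Finset.sum_congr rfl fun i _ => ?_
    rw [transpose_apply, hV, Matrix.of_apply]
  have hv : v = fun q : ι × ι => V q.1 q.2 := funext fun q => rfl
  have h1 : h * hᴴ = 1 := by
    have := Matrix.mem_unitaryGroup_iff.1 hh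
    rwa [star_eq_conjTranspose] at this
  have hTH : hᵀᴴ = hᴴᵀ := Matrix.ext fun _ _ => rfl
  have h2 : hᵀᴴ * hᵀ = 1 := by
    rw [hTH, ← transpose_mul, h1, transpose_one]
  have e1 : (hᵀ * V * h)ᴴ * (hᵀ * V * h) = hᴴ * (Vᴴ * V) * h := by
    rw [conjTranspose_mul, conjTranspose_mul]
    simp only [Matrix.mul_assoc]
    rw [← Matrix.mul_assoc hᵀᴴ, h2, Matrix.one_mul]
  have e2 : (hᴴ * (Vᴴ * V) * h).trace = (Vᴴ * V).trace := by
    rw [Matrix.trace_mul_comm, ← Matrix.mul_assoc, h1, Matrix.one_mul]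
  rw [hmat, star_dotProduct_uncurry_eq_trace, e1, e2]
  conv_rhs => rw [hv]
  rw [star_dotProduct_uncurry_eq_trace]

/-! ### The coordinate bound `‖P_w |T⟩‖² ≤ 2‖w‖²` -/

/-- Coefficients of `c_{p₂} c_{p₁} |T⟩`: the removed pair must be `T ∖ S = {p₁, p₂}`. [folklore] -/
theorem annihilation_pair_single_apply (p : ι × ι) (T S : Finset ι) :
    ((annihilation p.2 * annihilation p.1) *ᵥ (Pi.single T (1 : ℂ) : Fock ι)) S =
      if p.2 ∉ S ∧ p.1 ∉ S ∧ p.2 ≠ p.1 ∧ insert p.1 (insert p.2 S) = T then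
        jwSign p.2 S * jwSign p.1 (insert p.2 S) else 0 := by
  rw [annihilation_mul_annihilation_mulVec_apply, Pi.single_apply]
  by_cases h : p.2 ∉ S ∧ p.1 ∉ S ∧ p.2 ≠ p.1
  · obtain ⟨h1, h2, h3⟩ := h
    by_cases hT : insert p.1 (insert p.2 S) = T
    · rw [if_pos ⟨h1, h2, h3⟩, if_pos hT, if_pos ⟨h1, h2, h3, hT⟩, mul_one]
    · rw [if_pos ⟨h1, h2, h3⟩, if_neg hT, if_neg (fun h' => hT h'.2.2.2), mul_zero]
  · rw [if_neg h, if_neg (fun h' => h ⟨h'.1, h'.2.1, h'.2.2.1⟩)]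

/-- The coefficients of `c_{p₂} c_{p₁} |T⟩` have modulus at most one. [folklore] -/
theorem norm_annihilation_pair_single_apply_le (p : ι × ι) (T S : Finset ι) :
    ‖((annihilation p.2 * annihilation p.1) *ᵥ (Pi.single T (1 : ℂ) : Fock ι)) S‖ ≤ 1 := by
  rw [annihilation_pair_single_apply]
  split_ifs
  · rw [norm_mul, norm_jwSign, norm_jwSign, mul_one]
  · rw [norm_zero]
    exact zero_le_one

/-- `c_{p₂} c_{p₁} |T⟩` has at most one nonzero coefficient, at `S = T ∖ {p₁, p₂}`; hence
`Σ_S |(c_{p₂} c_{p₁} |T⟩)(S)|² ≤ 1`. [folklore] -/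
theorem sum_norm_sq_annihilation_pair_single_le (p : ι × ι) (T : Finset ι) :
    ∑ S : Finset ι, ‖((annihilation p.2 * annihilation p.1) *ᵥ (Pi.single T (1 : ℂ) : Fock ι)) S‖ ^ 2
      ≤ 1 := by
  rw [Finset.sum_eq_single ((T.erase p.1).erase p.2)]
  · have h := norm_annihilation_pair_single_apply_le p T ((T.erase p.1).erase p.2)
    have h0 := norm_nonneg (((annihilation p.2 * annihilation p.1) *ᵥ (Pi.single T (1 : ℂ) : Fock ι))
      ((T.erase p.1).erase p.2))
    nlinarith
  · intro S _ hS
    rw [annihilation_pair_single_apply, if_neg, norm_zero, zero_pow two_ne_zero]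
    rintro ⟨h2, h1, h3, hT⟩
    have hnot : p.1 ∉ insert p.2 S := fun hm =>
      (Finset.mem_insert.1 hm).elim (fun heq => h3 heq.symm) h1
    exact hS (by rw [← hT, Finset.erase_insert hnot, Finset.erase_insert h2])
  · exact fun h => absurd (Finset.mem_univ _) h

/-- For each configuration `S` at most the two orderings of the removed pair contribute to the
coefficient of `P_w |T⟩`, so by Cauchy–Schwarz
`|(P_w |T⟩)(S)|² ≤ 2 Σ_p |w_p|² |(c_{p₂} c_{p₁} |T⟩)(S)|²`. [folklore] -/
theorem norm_sq_pairAnnihilator_single_apply_le (w : ι × ι → ℂ) (T S : Finset ι) :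
    ‖(pairAnnihilator w *ᵥ (Pi.single T (1 : ℂ) : Fock ι)) S‖ ^ 2 ≤
      2 * ∑ p : ι × ι, ‖w p‖ ^ 2 *
        ‖((annihilation p.2 * annihilation p.1) *ᵥ (Pi.single T (1 : ℂ) : Fock ι)) S‖ ^ 2 := by
  set A : ι × ι → ℂ := fun p =>
    ((annihilation p.2 * annihilation p.1) *ᵥ (Pi.single T (1 : ℂ) : Fock ι)) S with hA
  have hcoef : (pairAnnihilator w *ᵥ (Pi.single T (1 : ℂ) : Fock ι)) S = ∑ p, w p * A p := by
    unfold pairAnnihilator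
    rw [sum_mulVec, Finset.sum_apply]
    refine Finset.sum_congr rfl fun p _ => ?_
    rw [smul_mulVec, Pi.smul_apply, smul_eq_mul]
  -- the support of `A` has at most two elements
  set E : Finset (ι × ι) := Finset.univ.filter (fun p : ι × ι => A p ≠ 0) with hE
  have hmemE : ∀ p, p ∈ E → p.2 ∉ S ∧ p.1 ∉ S ∧ p.2 ≠ p.1 ∧ insert p.1 (insert p.2 S) = T := by
    intro p hp
    rw [hE, Finset.mem_filter] at hp
    have h := hp.2
    rw [hA] at h
    simp only [] at h
    rw [annihilation_pair_single_apply] at h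
    by_contra hc
    exact h (if_neg hc)
  have hcard : E.card ≤ 2 := by
    rcases Finset.eq_empty_or_nonempty E with h0 | ⟨p₀, hp₀⟩
    · rw [h0, Finset.card_empty]
      exact Nat.zero_le _
    · obtain ⟨h2, h1, h21, hT⟩ := hmemE p₀ hp₀
      have hsub : E ⊆ {(p₀.1, p₀.2), (p₀.2, p₀.1)} := by
        intro p hp
        obtain ⟨hp2, hp1, hp21, hpT⟩ := hmemE p hp
        have m1 : p.1 ∈ T := by rw [← hpT]; exact Finset.mem_insert_self _ _
        have m2 : p.2 ∈ T := by
          rw [← hpT]; exact Finset.mem_insert_of_mem (Finset.mem_insert_self _ _)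
        rw [← hT, Finset.mem_insert, Finset.mem_insert] at m1 m2
        rw [Finset.mem_insert, Finset.mem_singleton]
        rcases m1 with e1 | e1 | e1
        · rcases m2 with e2 | e2 | e2
          · exact absurd (e2.trans e1.symm) hp21
          · exact Or.inl (Prod.ext e1 e2)
          · exact absurd e2 hp2
        · rcases m2 with e2 | e2 | e2
          · exact Or.inr (Prod.ext e1 e2)
          · exact absurd (e2.trans e1.symm) hp21
          · exact absurd e2 hp2
        · exact absurd e1 hp1
      exact (Finset.card_le_card hsub).trans (Finset.card_le_two)
  -- Cauchy–Schwarz on the (at most two) nonzero terms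
  have hsum : ∑ p ∈ E, w p * A p = ∑ p, w p * A p :=
    Finset.sum_filter_of_ne fun p _ hne hA0 => hne (by rw [hA0, mul_zero])
  have hnn : ∀ p, 0 ≤ ‖w p‖ * ‖A p‖ := fun p => by positivity
  calc ‖(pairAnnihilator w *ᵥ (Pi.single T (1 : ℂ) : Fock ι)) S‖ ^ 2
      = ‖∑ p ∈ E, w p * A p‖ ^ 2 := by rw [hcoef, hsum]
    _ ≤ (∑ p ∈ E, ‖w p‖ * ‖A p‖) ^ 2 := by
        gcongr
        refine (norm_sum_le _ _).trans (le_of_eq ?_)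
        exact Finset.sum_congr rfl fun p _ => norm_mul _ _
    _ ≤ E.card * ∑ p ∈ E, (‖w p‖ * ‖A p‖) ^ 2 := sq_sum_le_card_mul_sum_sq
    _ ≤ 2 * ∑ p ∈ E, (‖w p‖ * ‖A p‖) ^ 2 := by
        have h2 : (E.card : ℝ) ≤ 2 := by exact_mod_cast hcard
        exact mul_le_mul_of_nonneg_right h2 (Finset.sum_nonneg fun p _ => by positivity)
    _ ≤ 2 * ∑ p, (‖w p‖ * ‖A p‖) ^ 2 :=
        mul_le_mul_of_nonneg_left (Finset.sum_le_sum_of_subset_of_nonneg (Finset.subset_univ E)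
          fun p _ _ => by positivity) (by norm_num)
    _ = 2 * ∑ p : ι × ι, ‖w p‖ ^ 2 * ‖A p‖ ^ 2 := by
        congr 1
        exact Finset.sum_congr rfl fun p _ => mul_pow _ _ 2

/-- **The coordinate Slater bound**: `‖P_w |T⟩‖² ≤ 2 ‖w‖²` for every occupation-basis vector `|T⟩`
and every pair function `w` (the largest eigenvalue of `ρ₂` of a Slater determinant is `2` in
Yang's normalisation). [cite: Yang1962, §3] -/
theorem normSq_pairAnnihilator_single_le (w : ι × ι → ℂ) (T : Finset ι) :
    normSq (pairAnnihilator w *ᵥ (Pi.single T (1 : ℂ) : Fock ι)) ≤ 2 * ∑ p : ι × ι, ‖w p‖ ^ 2 := by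
  calc normSq (pairAnnihilator w *ᵥ (Pi.single T (1 : ℂ) : Fock ι))
      = ∑ S, ‖(pairAnnihilator w *ᵥ (Pi.single T (1 : ℂ) : Fock ι)) S‖ ^ 2 := rfl
    _ ≤ ∑ S : Finset ι, 2 * ∑ p : ι × ι, ‖w p‖ ^ 2 *
          ‖((annihilation p.2 * annihilation p.1) *ᵥ (Pi.single T (1 : ℂ) : Fock ι)) S‖ ^ 2 :=
        Finset.sum_le_sum fun S _ => norm_sq_pairAnnihilator_single_apply_le w T S
    _ = 2 * ∑ p : ι × ι, ‖w p‖ ^ 2 * ∑ S : Finset ι,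
          ‖((annihilation p.2 * annihilation p.1) *ᵥ (Pi.single T (1 : ℂ) : Fock ι)) S‖ ^ 2 := by
        rw [← Finset.mul_sum, Finset.sum_comm]
        congr 1
        exact Finset.sum_congr rfl fun p _ => (Finset.mul_sum _ _ _).symm
    _ ≤ 2 * ∑ p : ι × ι, ‖w p‖ ^ 2 * 1 := by
        gcongr with p
        exact sum_norm_sq_annihilation_pair_single_le p T
    _ = 2 * ∑ p : ι × ι, ‖w p‖ ^ 2 := by simp only [mul_one]

end Literature.MathematicalPhysics.QuantumLattice
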